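import Summits.ResolutionOfSingularities.ResolutionOfSingularities.Theses.FrobeniusLadder
import Literature.RingTheory.TightClosure.TightClosure
import Summits.ResolutionOfSingularities.ResolutionOfSingularities.Theorems.FrobeniusLadderFRationalModificationFlatDescent
import Summits.ResolutionOfSingularities.ResolutionOfSingularities.Theorems.FrobeniusLadderFRationalModificationDeformFW
import Summits.ResolutionOfSingularities.ResolutionOfSingularities.Theorems.FrobeniusLadderFRationalModificationPowerLift
import Summits.ResolutionOfSingularities.ResolutionOfSingularities.Theorems.FrobeniusLadderFRationalModificationExchange
import Summits.ResolutionOfSingularities.ResolutionOfSingularities.Theorems.FrobeniusLadderFRationalModificationAdaptedGenerators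
import Summits.ResolutionOfSingularities.ResolutionOfSingularities.Theorems.FrobeniusLadderFRationalModificationSopWeaklyRegular
import Summits.ResolutionOfSingularities.ResolutionOfSingularities.Theorems.FrobeniusLadderFRationalModificationReduction
import Summits.ResolutionOfSingularities.ResolutionOfSingularities.Theorems.FRationalModification.Negative.LoadBearing
import Mathlib.AlgebraicGeometry.Noetherian
import HarnessLib

/-!
# Crux `FRationalModification` — it is EQUIVALENT to the open stub `stub_integralModel` of line `Sketch`

Support lemmas for crux stmt-ResolutionOfSingularities-15316
(`Summit.ResolutionOfSingularities.ResolutionOfSingularities.Theses.FrobeniusLadder.FRationalModification`,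
route `FrobeniusLadder`, rung 3: a reduced separated finite-type `X/k`, `char k = p`, with a locally
integral Cohen–Macaulay F-injective proper birational model has an F-rational proper birational model),
filed by the line lead (line `Sketch`, skeleton `Cruxes/FRationalModification/Lines/Sketch.lean` v6).
They certify the SIZE of what the line leaves open:

* §1 `isFRational_of_FW`, `rungThree_of_chart` — the composition of the six landed algebra stubs
  (Fedder–Watanabe 2.13 deformation, power lift, exchange, adapted generators, Matsumura 17.4 (iii),
  flat descent): Fedder–Watanabe data on a Noetherian local domain `S` make `S` F-rational, and a
  faithfully flat equidimensional local chart `R → S` with `S` F-rational (or FW-certified) makes the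
  crux's rung-3 clause hold at `R`.
* §2 `fRationalModification_of_integralModel` — the skeleton's composition with its ONE open stub as a
  hypothesis, sorry-free: the integral model form with charts (`IntegralModelForm p`, written inline:
  every INTEGRAL separated finite-type `Y/k` with rung-2 stalks has a proper birational model every
  stalk of which admits an F-rational-or-FW flat chart) implies the crux (`Reduction.stub_reduction` +
  `rungThree_of_chart`).
* §3 `integralModel_of_fRationalModification` — conversely the crux implies the stub outright (an
  integral rung-2 `Y` is reduced and is its own rung-2 model along `𝟙 Y`; the crux's F-rational model,
  charted by its own stalks, is a witness). Hence `fRationalModification_iff_integralModel`: the open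
  stub IS the crux, in the geometry every idea card works in (integral base, the rung-2 scheme itself to
  be modified, certificates consumed by the landed algebra).
* §4 `fRationalModification_iff_integral` — the plain integral form without charts ("every integral
  separated finite-type rung-2 `Y/k` has a rung-3 proper birational model") is likewise equivalent to the
  crux: the sentence "equivalent to 'every integral CM F-injective variety has a proper birational
  F-rational model' modulo folklore" of the item text, proved.

No definition is declared; every statement is written inline in the route file's vocabulary.
-/

-- single-problem summit: the doubled namespace component `ResolutionOfSingularities` is forced
set_option linter.dupNamespace false

noncomputable section

open CategoryTheory AlgebraicGeometry TopologicalSpace IsLocalRing RingTheory.Sequence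
open Literature.RingTheory.TightClosure Literature.AlgebraicGeometry.Resolution
open Summit.ResolutionOfSingularities.ResolutionOfSingularities.Theses.FrobeniusLadder

namespace Summit.ResolutionOfSingularities.ResolutionOfSingularities.Theorems.FRationalModification.IntegralModel

/-! ## §1 Chart data ⇒ the rung-3 clause (composition of the landed algebra) -/

section Glue

variable {R : Type*} [CommRing R]

/-- Two families of generators lying in each other's radical generate ideals with the same radical.
[folklore] -/
theorem radical_span_eq_of_subset_radical {A B : Set R}
    (hAB : A ⊆ (Ideal.span B).radical) (hBA : B ⊆ (Ideal.span A).radical) :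
    (Ideal.span A).radical = (Ideal.span B).radical :=
  le_antisymm (Ideal.radical_le_radical_iff.mpr (Ideal.span_le.mpr hAB))
    (Ideal.radical_le_radical_iff.mpr (Ideal.span_le.mpr hBA))

/-- Raising the distinguished generator of `(f, s)` to a positive power does not change the radical.
[folklore] -/
theorem radical_span_insert_pow_eq {d : ℕ} (f : R) (s : Fin d → R) {a : ℕ} (ha : 0 < a) :
    (Ideal.span (insert (f ^ a) (Set.range s))).radical =
      (Ideal.span (insert f (Set.range s))).radical := by
  have hf : f ∈ Ideal.span (insert f (Set.range s)) := Ideal.subset_span (Set.mem_insert _ _)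
  have hs : ∀ i, s i ∈ Ideal.span (insert f (Set.range s)) := fun i =>
    Ideal.subset_span (Set.mem_insert_of_mem _ (Set.mem_range_self i))
  have hfa : f ^ a ∈ Ideal.span (insert (f ^ a) (Set.range s)) :=
    Ideal.subset_span (Set.mem_insert _ _)
  have hsa : ∀ i, s i ∈ Ideal.span (insert (f ^ a) (Set.range s)) := fun i =>
    Ideal.subset_span (Set.mem_insert_of_mem _ (Set.mem_range_self i))
  apply radical_span_eq_of_subset_radical
  · rintro x (rfl | ⟨i, rfl⟩)
    · exact Ideal.le_radical (Ideal.pow_mem_of_mem _ hf _ ha)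
    · exact Ideal.le_radical (hs i)
  · rintro x (rfl | ⟨i, rfl⟩)
    · exact Ideal.mem_radical_iff.mpr ⟨a, hfa⟩
    · exact Ideal.le_radical (hsa i)

end Glue

/-- **Fedder–Watanabe data ⇒ F-rational.** On a Noetherian local domain `S` of characteristic `p`
which is Cohen–Macaulay (every system of parameters a weakly regular sequence) and carries `g ∈ 𝔪`,
`g ≠ 0`, with `S/gS` F-injective written upstairs at every completion of `g` to a system of parameters
and `gⁿ` a parameter test element, every ideal generated by a system of parameters is tightly closed:
regenerate a parameter ideal `(t)` as `(b, u)` around a completion `u` of `g`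
(`AdaptedGenerators.stub_adaptedGenerators`), get `(g, u)` tightly closed (`DeformFW.stub_deformFW`,
Fedder–Watanabe 2.13), lift to `(gᴺ, u)` with `gᴺ ∈ (t)` (`PowerLift.stub_powerLift`), and exchange
`gᴺ` for `b` (`Exchange.stub_exchange`). [cite: FedderWatanabe1989, Prop. 2.13] -/
theorem isFRational_of_FW (p : ℕ) [Fact p.Prime] {S : Type*} [CommRing S] [IsLocalRing S]
    [IsNoetherianRing S] [IsDomain S] [CharP S p]
    (hCM : ∀ ⦃n : ℕ⦄ (s : Fin n → S), IsSystemOfParameters s → IsWeaklyRegular S (List.ofFn s))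
    {d : ℕ} {g : S} (hd : ringKrullDim S = ((d + 1 : ℕ) : WithBot ℕ∞))
    (hgm : g ∈ maximalIdeal S) (hg0 : g ≠ 0)
    (hFinj : ∀ s : Fin d → S, (Ideal.span (insert g (Set.range s))).radical = maximalIdeal S →
      ∀ (y : S) (e : ℕ), y ^ p ^ e ∈
        Ideal.span {g} ⊔ frobeniusPower (p ^ e) (Ideal.span (Set.range s)) →
        y ∈ Ideal.span (insert g (Set.range s)))
    (htest : ∃ n : ℕ, ∀ ⦃m : ℕ⦄ (s : Fin m → S), IsSystemOfParameters s →
      ∀ y ∈ tightClosure p (Ideal.span (Set.range s)), g ^ n * y ∈ Ideal.span (Set.range s)) :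
    IsFRational S p := by
  intro n t ht
  obtain ⟨hdim, hrad⟩ := ht
  have hn : n = d + 1 := by
    have h := hdim.symm.trans hd
    exact_mod_cast h
  subst hn
  obtain ⟨b, u, htu, hgu⟩ := AdaptedGenerators.stub_adaptedGenerators hd hgm hg0 t hrad
  have hgu_tc : IsTightlyClosed p (Ideal.span (insert g (Set.range u))) :=
    DeformFW.stub_deformFW p hCM hd hgu (hFinj u hgu) htest
  obtain ⟨N, hN⟩ := Ideal.exists_pow_le_of_le_radical_of_fg hrad.ge
    (IsNoetherian.noetherian (maximalIdeal S))
  have hgN : g ^ (N + 1) ∈ Ideal.span (insert b (Set.range u)) := by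
    rw [← htu]
    exact ((Ideal.pow_le_pow_right (Nat.le_succ N)).trans hN) (Ideal.pow_mem_pow hgm _)
  have hgNu_tc : IsTightlyClosed p (Ideal.span (insert (g ^ (N + 1)) (Set.range u))) :=
    PowerLift.stub_powerLift p hCM hd hgu hgu_tc (Nat.succ_pos N)
  have hgNu_rad : (Ideal.span (insert (g ^ (N + 1)) (Set.range u))).radical = maximalIdeal S := by
    rw [radical_span_insert_pow_eq g u (Nat.succ_pos N), hgu]
  rw [htu]
  exact Exchange.stub_exchange p hCM hd hgNu_rad hgN hgNu_tc

/-- **Chart data ⇒ the rung-3 clause at the stalk.** If the local ring `R` admits a faithfully flat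
local chart `R → S` of the same dimension with zero-dimensional closed fibre (`𝔪_S ⊆ rad(𝔪_R S)`),
`S` a Noetherian local domain of characteristic `p` that is F-rational or carries Fedder–Watanabe data
(Cohen–Macaulay as "a regular sequence in `𝔪_S` of length `dim S`"; `g`; F-injectivity of `S/gS`
upstairs; `gⁿ` a parameter test element), then `R` is a domain in which every ideal generated by a
system of parameters is tightly closed (the crux's inline clause): `S` is F-rational in either branch
(`SopWeaklyRegular.stub_sopWeaklyRegular` + `isFRational_of_FW`) and the clause descends
(`FlatDescent.stub_flatDescent`). [cite: HochsterHuneke1994, (4.1)–(4.2); FedderWatanabe1989, Prop. 2.13] -/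
theorem rungThree_of_chart (p : ℕ) [Fact p.Prime] {R : Type} [CommRing R] [IsLocalRing R]
    (hchart : ∃ (S : Type) (_ : CommRing S) (_ : IsLocalRing S) (_ : IsNoetherianRing S)
        (_ : IsDomain S) (_ : CharP S p) (_ : Algebra R S),
        Module.FaithfullyFlat R S ∧
        ringKrullDim S = ringKrullDim R ∧
        maximalIdeal S ≤ ((maximalIdeal R).map (algebraMap R S)).radical ∧
        (IsFRational S p ∨
          ((∃ rs : List S, RingTheory.Sequence.IsRegular S rs ∧ (∀ r ∈ rs, r ∈ maximalIdeal S) ∧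
              (rs.length : WithBot ℕ∞) = ringKrullDim S) ∧
            ∃ (d : ℕ) (g : S), ringKrullDim S = ((d + 1 : ℕ) : WithBot ℕ∞) ∧
              g ∈ maximalIdeal S ∧ g ≠ 0 ∧
              (∀ s : Fin d → S, (Ideal.span (insert g (Set.range s))).radical = maximalIdeal S →
                ∀ (y : S) (e : ℕ), y ^ p ^ e ∈
                  Ideal.span {g} ⊔ frobeniusPower (p ^ e) (Ideal.span (Set.range s)) →
                  y ∈ Ideal.span (insert g (Set.range s))) ∧
              (∃ n : ℕ, ∀ ⦃m : ℕ⦄ (s : Fin m → S), IsSystemOfParameters s →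
                ∀ y ∈ tightClosure p (Ideal.span (Set.range s)),
                  g ^ n * y ∈ Ideal.span (Set.range s))))) :
    IsDomain R ∧ ∀ d : ℕ, ringKrullDim R = d → ∀ s : Fin d → R,
      (Ideal.span (Set.range s)).radical.IsMaximal → ∀ y c : R, c ≠ 0 →
        (∀ e : ℕ, c * y ^ p ^ e ∈
          Ideal.span ((fun z : R => z ^ p ^ e) '' (Ideal.span (Set.range s) : Set R))) →
        y ∈ Ideal.span (Set.range s) := by
  obtain ⟨S, _, _, _, _, _, _, hff, hdim, hfib, hS⟩ := hchart
  have hFR : IsFRational S p := by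
    rcases hS with h | ⟨hCM, d, g, hd, hgm, hg0, hFinj, htest⟩
    · exact h
    · exact isFRational_of_FW p (fun n s hs => SopWeaklyRegular.stub_sopWeaklyRegular hCM s hs)
        hd hgm hg0 hFinj htest
  exact FlatDescent.stub_flatDescent p hdim hfib hFR

/-! ## §2 The integral model form (the open stub, as a hypothesis) implies the crux -/

/-- **`stub_integralModel` ⇒ crux** — the skeleton `Lines/Sketch.lean` v6 with its one open stub turned
into a hypothesis, sorry-free. The hypothesis is the registered stub signature of `stub_integralModel`,
universally quantified verbatim: every INTEGRAL separated finite-type `Y/k` (`char k = p`, `Fact p.Prime`)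
with rung-2 stalks has a proper birational model every stalk of which admits a faithfully flat
equidimensional local chart that is F-rational or carries Fedder–Watanabe data. Proof: reduce to the
integral model form (`Reduction.stub_reduction`) and convert chart data to the rung-3 clause pointwise
(`rungThree_of_chart`). [folklore] -/
theorem fRationalModification_of_integralModel
    (hIM : ∀ (p : ℕ) [Fact p.Prime] (k : Type) [Field k] [CharP k p] (Y : Scheme.{0})
      (g : Y ⟶ Spec (.of k)) [IsSeparated g] [LocallyOfFiniteType g] [QuasiCompact g] [IsIntegral Y],
      (∀ y : Y, IsDomain (Y.presheaf.stalk y) ∧ ∀ d : ℕ, ringKrullDim (Y.presheaf.stalk y) = d →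
        ∀ s : Fin d → Y.presheaf.stalk y, (Ideal.span (Set.range s)).radical.IsMaximal →
          RingTheory.Sequence.IsWeaklyRegular (Y.presheaf.stalk y) (List.ofFn s) ∧
          ∀ w : Y.presheaf.stalk y, (∃ e : ℕ, w ^ p ^ e ∈
            Ideal.span ((fun z : Y.presheaf.stalk y => z ^ p ^ e) ''
              (Ideal.span (Set.range s) : Set (Y.presheaf.stalk y)))) →
            w ∈ Ideal.span (Set.range s)) →
      ∃ (Y₂ : Scheme.{0}) (π : Y₂ ⟶ Y), IsProper π ∧ IsBirational π ∧
        ∀ x : Y₂, ∃ (S : Type) (_ : CommRing S) (_ : IsLocalRing S) (_ : IsNoetherianRing S)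
          (_ : IsDomain S) (_ : CharP S p) (_ : Algebra (Y₂.presheaf.stalk x) S),
          Module.FaithfullyFlat (Y₂.presheaf.stalk x) S ∧
          ringKrullDim S = ringKrullDim (Y₂.presheaf.stalk x) ∧
          maximalIdeal S ≤ ((maximalIdeal (Y₂.presheaf.stalk x)).map
            (algebraMap (Y₂.presheaf.stalk x) S)).radical ∧
          (IsFRational S p ∨
            ((∃ rs : List S, RingTheory.Sequence.IsRegular S rs ∧ (∀ r ∈ rs, r ∈ maximalIdeal S) ∧
                (rs.length : WithBot ℕ∞) = ringKrullDim S) ∧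
              ∃ (d : ℕ) (g : S), ringKrullDim S = ((d + 1 : ℕ) : WithBot ℕ∞) ∧
                g ∈ maximalIdeal S ∧ g ≠ 0 ∧
                (∀ s : Fin d → S, (Ideal.span (insert g (Set.range s))).radical = maximalIdeal S →
                  ∀ (y : S) (e : ℕ), y ^ p ^ e ∈
                    Ideal.span {g} ⊔ frobeniusPower (p ^ e) (Ideal.span (Set.range s)) →
                    y ∈ Ideal.span (insert g (Set.range s))) ∧
                (∃ n : ℕ, ∀ ⦃m : ℕ⦄ (s : Fin m → S), IsSystemOfParameters s →
                  ∀ y ∈ tightClosure p (Ideal.span (Set.range s)),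
                    g ^ n * y ∈ Ideal.span (Set.range s))))) :
    FRationalModification := by
  intro p hp k _ _ X f hsep hft hqc _ hX₁
  haveI : Fact p.Prime := ⟨hp⟩
  haveI := hsep; haveI := hft; haveI := hqc
  refine Reduction.stub_reduction p k X f (fun Y g hs hl hq hY h₂ => ?_) hX₁
  haveI := hs; haveI := hl; haveI := hq; haveI := hY
  obtain ⟨Y₂, π, hπ, hbir, hchart⟩ := hIM p k Y g h₂
  exact ⟨Y₂, π, hπ, hbir, fun x => rungThree_of_chart p (hchart x)⟩

/-! ## §3 The crux implies the integral model form: the open stub IS the crux -/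

/-- **Crux ⇒ `stub_integralModel`**: an integral separated finite-type `Y/k` with rung-2 stalks is
reduced and is its own rung-2 model along `𝟙 Y` (birational over `⊤`), so the crux yields a proper
birational `Y₂ → Y` with rung-3 stalks; each stalk `R = 𝒪_{Y₂,x}` is then its own chart (`S = R`,
faithfully flat over itself, `𝔪 ⊆ rad 𝔪`), F-rational by `isFRational_iff_of_isDomain` (the rung-3
clause is literally F-rationality of a local domain), Noetherian because `Y₂` is locally of finite type
over `k`, of characteristic `p` (it receives `k`). The statement after `→` is the registered stub
signature of `stub_integralModel`, universally quantified verbatim. [folklore] -/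
theorem integralModel_of_fRationalModification (h : FRationalModification) :
    ∀ (p : ℕ) [Fact p.Prime] (k : Type) [Field k] [CharP k p] (Y : Scheme.{0})
      (g : Y ⟶ Spec (.of k)) [IsSeparated g] [LocallyOfFiniteType g] [QuasiCompact g] [IsIntegral Y],
      (∀ y : Y, IsDomain (Y.presheaf.stalk y) ∧ ∀ d : ℕ, ringKrullDim (Y.presheaf.stalk y) = d →
        ∀ s : Fin d → Y.presheaf.stalk y, (Ideal.span (Set.range s)).radical.IsMaximal →
          RingTheory.Sequence.IsWeaklyRegular (Y.presheaf.stalk y) (List.ofFn s) ∧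
          ∀ w : Y.presheaf.stalk y, (∃ e : ℕ, w ^ p ^ e ∈
            Ideal.span ((fun z : Y.presheaf.stalk y => z ^ p ^ e) ''
              (Ideal.span (Set.range s) : Set (Y.presheaf.stalk y)))) →
            w ∈ Ideal.span (Set.range s)) →
      ∃ (Y₂ : Scheme.{0}) (π : Y₂ ⟶ Y), IsProper π ∧ IsBirational π ∧
        ∀ x : Y₂, ∃ (S : Type) (_ : CommRing S) (_ : IsLocalRing S) (_ : IsNoetherianRing S)
          (_ : IsDomain S) (_ : CharP S p) (_ : Algebra (Y₂.presheaf.stalk x) S),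
          Module.FaithfullyFlat (Y₂.presheaf.stalk x) S ∧
          ringKrullDim S = ringKrullDim (Y₂.presheaf.stalk x) ∧
          maximalIdeal S ≤ ((maximalIdeal (Y₂.presheaf.stalk x)).map
            (algebraMap (Y₂.presheaf.stalk x) S)).radical ∧
          (IsFRational S p ∨
            ((∃ rs : List S, RingTheory.Sequence.IsRegular S rs ∧ (∀ r ∈ rs, r ∈ maximalIdeal S) ∧
                (rs.length : WithBot ℕ∞) = ringKrullDim S) ∧
              ∃ (d : ℕ) (g : S), ringKrullDim S = ((d + 1 : ℕ) : WithBot ℕ∞) ∧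
                g ∈ maximalIdeal S ∧ g ≠ 0 ∧
                (∀ s : Fin d → S, (Ideal.span (insert g (Set.range s))).radical = maximalIdeal S →
                  ∀ (y : S) (e : ℕ), y ^ p ^ e ∈
                    Ideal.span {g} ⊔ frobeniusPower (p ^ e) (Ideal.span (Set.range s)) →
                    y ∈ Ideal.span (insert g (Set.range s))) ∧
                (∃ n : ℕ, ∀ ⦃m : ℕ⦄ (s : Fin m → S), IsSystemOfParameters s →
                  ∀ y ∈ tightClosure p (Ideal.span (Set.range s)),
                    g ^ n * y ∈ Ideal.span (Set.range s)))) := by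
  intro p _ k _ _ Y g _ _ _ _ h₂
  have hp : p.Prime := Fact.out
  obtain ⟨Y₂, π, hπ, hbir, h₃⟩ := h p hp k Y g inferInstance inferInstance inferInstance inferInstance
    ⟨Y, 𝟙 Y, inferInstance, ⟨⊤, by simp, by simp, inferInstance⟩, h₂⟩
  haveI := hπ
  haveI : IsLocallyNoetherian Y₂ := LocallyOfFiniteType.isLocallyNoetherian (π ≫ g)
  refine ⟨Y₂, π, hπ, hbir, fun x => ?_⟩
  obtain ⟨hdom, htc⟩ := h₃ x
  haveI := hdom
  haveI : CharP (Y₂.presheaf.stalk x) p := Negative.charP_stalk (π ≫ g) x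
  refine ⟨Y₂.presheaf.stalk x, inferInstance, inferInstance, inferInstance, inferInstance,
    inferInstance, Algebra.id _, inferInstance, rfl, fun m hm => Ideal.le_radical (Ideal.mem_map_of_mem _ hm),
    Or.inl ((isFRational_iff_of_isDomain p).mpr htc)⟩

/-- **The open stub IS the crux**: `FRationalModification ↔ stub_integralModel` (universally
quantified registered signature). Line `Sketch` therefore bottoms out at exactly one crux-sized stub —
F-rationalification of INTEGRAL Cohen–Macaulay F-injective varieties, in chart form — and everything
else of the line (six algebra stubs, the reduction) is landed. [folklore] -/
theorem fRationalModification_iff_integralModel :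
    FRationalModification ↔
      ∀ (p : ℕ) [Fact p.Prime] (k : Type) [Field k] [CharP k p] (Y : Scheme.{0})
        (g : Y ⟶ Spec (.of k)) [IsSeparated g] [LocallyOfFiniteType g] [QuasiCompact g] [IsIntegral Y],
        (∀ y : Y, IsDomain (Y.presheaf.stalk y) ∧ ∀ d : ℕ, ringKrullDim (Y.presheaf.stalk y) = d →
          ∀ s : Fin d → Y.presheaf.stalk y, (Ideal.span (Set.range s)).radical.IsMaximal →
            RingTheory.Sequence.IsWeaklyRegular (Y.presheaf.stalk y) (List.ofFn s) ∧
            ∀ w : Y.presheaf.stalk y, (∃ e : ℕ, w ^ p ^ e ∈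
              Ideal.span ((fun z : Y.presheaf.stalk y => z ^ p ^ e) ''
                (Ideal.span (Set.range s) : Set (Y.presheaf.stalk y)))) →
              w ∈ Ideal.span (Set.range s)) →
        ∃ (Y₂ : Scheme.{0}) (π : Y₂ ⟶ Y), IsProper π ∧ IsBirational π ∧
          ∀ x : Y₂, ∃ (S : Type) (_ : CommRing S) (_ : IsLocalRing S) (_ : IsNoetherianRing S)
            (_ : IsDomain S) (_ : CharP S p) (_ : Algebra (Y₂.presheaf.stalk x) S),
            Module.FaithfullyFlat (Y₂.presheaf.stalk x) S ∧
            ringKrullDim S = ringKrullDim (Y₂.presheaf.stalk x) ∧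
            maximalIdeal S ≤ ((maximalIdeal (Y₂.presheaf.stalk x)).map
              (algebraMap (Y₂.presheaf.stalk x) S)).radical ∧
            (IsFRational S p ∨
              ((∃ rs : List S, RingTheory.Sequence.IsRegular S rs ∧ (∀ r ∈ rs, r ∈ maximalIdeal S) ∧
                  (rs.length : WithBot ℕ∞) = ringKrullDim S) ∧
                ∃ (d : ℕ) (g : S), ringKrullDim S = ((d + 1 : ℕ) : WithBot ℕ∞) ∧
                  g ∈ maximalIdeal S ∧ g ≠ 0 ∧
                  (∀ s : Fin d → S, (Ideal.span (insert g (Set.range s))).radical = maximalIdeal S →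
                    ∀ (y : S) (e : ℕ), y ^ p ^ e ∈
                      Ideal.span {g} ⊔ frobeniusPower (p ^ e) (Ideal.span (Set.range s)) →
                      y ∈ Ideal.span (insert g (Set.range s))) ∧
                  (∃ n : ℕ, ∀ ⦃m : ℕ⦄ (s : Fin m → S), IsSystemOfParameters s →
                    ∀ y ∈ tightClosure p (Ideal.span (Set.range s)),
                      g ^ n * y ∈ Ideal.span (Set.range s)))) :=
  ⟨integralModel_of_fRationalModification, fRationalModification_of_integralModel⟩

end Summit.ResolutionOfSingularities.ResolutionOfSingularities.Theorems.FRationalModification.IntegralModel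

end
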